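import Mathlib.GroupTheory.OrderOfElement
import Mathlib.Data.Set.Card
import Mathlib.Algebra.Module.Defs
import HarnessLib

/-!
# The structure of a stable `p`-divisible line in a torsion group: a coherent generator chain
# `xₙ` of exact order `p^{n+1}`, cyclicity of each level, and the orbit bound
# `#{d·xₙ} ≤ p^{n+1}` (Serre 1967, §5, proof of Prop. 8; proofs only)

`Proofs`-style file (THEOREMS ONLY), topic `NumberTheory/EllipticCurves`, paper group `Serre1967`.
In the proof of §5 Prop. 8 of J.-P. Serre, *Sur les groupes de Galois attachés aux groupes
p-divisibles* (Driebergen 1966), a primitive vector `z ∈ T ∖ pT` of the Tate module gives images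
`zₙ ∈ T'ₙ` of EXACT order `pⁿ` in `Tₙ = T/pⁿT` («l'image `zₙ` de `z` dans `T/pⁿT = Tₙ` appartient à
`T'ₙ`»), and the size of the orbit `G·zₙ = [K(zₙ):K]` is compared with Lemme 3. The tree's torsion
form of that proposition (`Serre1967.noStableDivisibleLine_of_potentiallySupersingular`) speaks instead
of a `p`-DIVISIBLE subgroup `N` of the `p`-primary torsion, stable under a group (or monoid) `D`, with
at most `p` elements killed by `p`. This file extracts from such an `N ≠ 0` the data the ramification
argument consumes, in pure group theory (any additive commutative group `G` with a distributive action
of a monoid `D`):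

* `exists_chain_of_divisible` — a chain `x : ℕ → G` in `N` with `x 0 ≠ 0`, `p • x 0 = 0` and
  `p • x (n+1) = x n`;
* `addOrderOf_chain` — `xₙ` has exact order `p^{n+1}`;
* `mem_zmultiples_chain_of_mem` — **cyclicity of the levels**: every `c ∈ N` with `p^{n+1} • c = 0`
  is a multiple of `xₙ` (induction from the level `0`, where `N[p]` has `≤ p` elements and contains
  the `p` distinct multiples of `x₀`);
* `exists_smul_chain_eq_nsmul`, `ncard_orbit_chain_le` — hence every `d ∈ D` acts on `xₙ` as a
  multiplication by some `m < p^{n+1}`, and **the orbit `{d • xₙ : d ∈ D}` has at most `p^{n+1}`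
  elements** — the degree bound `[K_𝔭(xₙ) : K_𝔭] ≤ p^{n+1}` (for `D = D_𝔭`) that Serre's Lemme 3
  (`e(K(x)/K) ≥ c·p^{2n}` at height `2`) contradicts for `n ≫ 0`
  (`Serre1967.false_of_forall_mul_le_or_le_sub_of_forall_div_pow_le`, `r = p < q = p²`).

## References

* J.-P. Serre, Proc. Conf. Local Fields (Driebergen 1966), Springer 1967, 118–131, §5, proof of
  Prop. 8 (and Lemme 3). [Serre1967GroupesPDivisibles]
-/

namespace Literature.NumberTheory.EllipticCurves.Serre1967

variable {G : Type*} [AddCommGroup G] (p : ℕ) [hp : Fact p.Prime] (N : AddSubgroup G)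

omit hp in
/-- **A coherent chain in a non-zero `p`-divisible `p`-primary subgroup** (Serre: `z ∈ T ∖ pT`,
`zₙ ∈ T'ₙ`): if every element of `N` is killed by a power of `p`, `N` is `p`-divisible inside itself
and `N ≠ 0`, there is `x : ℕ → N`-valued with `x₀ ≠ 0`, `p·x₀ = 0`, `p·x_{n+1} = xₙ`.
[cite: Serre1967GroupesPDivisibles, §5 Prop. 8 (proof)] -/
theorem exists_chain_of_divisible (htors : ∀ c ∈ N, ∃ k : ℕ, p ^ k • c = 0)
    (hdiv : ∀ c ∈ N, ∃ c' ∈ N, p • c' = c) (hN : N ≠ ⊥) :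
    ∃ x : ℕ → G, (∀ n, x n ∈ N) ∧ x 0 ≠ 0 ∧ p • x 0 = 0 ∧ ∀ n, p • x (n + 1) = x n := by
  classical
  -- a non-zero element of order exactly `p`
  obtain ⟨c, hcN, hc0⟩ : ∃ c ∈ N, c ≠ 0 := by
    by_contra hall
    push Not at hall
    exact hN ((AddSubgroup.eq_bot_iff_forall _).mpr hall)
  have hex : ∃ k : ℕ, p ^ k • c = 0 := htors c hcN
  set k := Nat.find hex with hk
  have hk0 : p ^ k • c = 0 := Nat.find_spec hex
  have hkpos : 0 < k := by
    by_contra h0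
    have : k = 0 := by omega
    rw [this, pow_zero, one_smul] at hk0
    exact hc0 hk0
  obtain ⟨j, hj⟩ : ∃ j, k = j + 1 := ⟨k - 1, by omega⟩
  have hx0ne : p ^ j • c ≠ 0 := by
    have hmin := Nat.find_min hex (m := j) (by omega)
    exact hmin
  -- the chain, by recursion on divisibility
  have hsucc : ∀ y : {y : G // y ∈ N}, ∃ y' : {y : G // y ∈ N}, p • (y' : G) = y := fun y => by
    obtain ⟨c', hc'N, hc'⟩ := hdiv y.1 y.2
    exact ⟨⟨c', hc'N⟩, hc'⟩
  choose f hf using hsucc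
  let x : ℕ → {y : G // y ∈ N} := fun n => Nat.rec ⟨p ^ j • c, N.nsmul_mem hcN _⟩ (fun _ y => f y) n
  refine ⟨fun n => (x n).1, ?_, ?_, ?_, ?_⟩
  · exact fun n => (x n).2
  · exact hx0ne
  · change p • (p ^ j • c) = 0
    rw [← mul_smul, ← pow_succ', ← hj, hk0]
  · exact fun n => hf (x n)

variable {p N}

omit hp in
/-- Along a chain `p·x₀ = 0`, `p·x_{n+1} = xₙ`: `pⁿ·xₙ = x₀` and `p^{n+1}·xₙ = 0`. Private. [folklore] -/
private theorem pow_smul_chain {x : ℕ → G} (h0 : p • x 0 = 0) (hs : ∀ n, p • x (n + 1) = x n) (n : ℕ) :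
    p ^ n • x n = x 0 ∧ p ^ (n + 1) • x n = 0 := by
  induction n with
  | zero => exact ⟨by rw [pow_zero, one_smul], by rw [zero_add, pow_one, h0]⟩
  | succ n ih =>
    constructor
    · rw [pow_succ, mul_smul, hs n, ih.1]
    · rw [pow_succ, mul_smul, hs n, ih.2]

/-- **`xₙ` has exact order `p^{n+1}`** along a chain with `x₀ ≠ 0`, `p·x₀ = 0`, `p·x_{n+1} = xₙ`
(Serre: `zₙ ∈ T'ₙ`). [cite: Serre1967GroupesPDivisibles, §5 Prop. 8 (proof)] -/
theorem addOrderOf_chain {x : ℕ → G} (hx0 : x 0 ≠ 0) (h0 : p • x 0 = 0)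
    (hs : ∀ n, p • x (n + 1) = x n) (n : ℕ) : addOrderOf (x n) = p ^ (n + 1) := by
  refine addOrderOf_eq_prime_pow (fun h => hx0 ?_) (pow_smul_chain h0 hs n).2
  rw [← (pow_smul_chain h0 hs n).1, h]

/-- **Cyclicity of the levels**: if `N[p] = {c ∈ N : p·c = 0}` is finite with at most `p` elements,
then along a chain in `N` (`x₀ ≠ 0`, `p·x₀ = 0`, `p·x_{n+1} = xₙ`) every `c ∈ N` with
`p^{n+1}·c = 0` is a natural multiple of `xₙ` (`N[p^{n+1}] = ⟨xₙ⟩ ≅ ℤ/p^{n+1}`, i.e. `N ≅ ℚ_p/ℤ_p`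
as Serre's `T ⊗ ℚ_p/ℤ_p` with `T ≅ ℤ_p` a line). [cite: Serre1967GroupesPDivisibles, §5 Prop. 8 (proof)] -/
theorem mem_range_nsmul_chain_of_mem {x : ℕ → G} (hxN : ∀ n, x n ∈ N) (hx0 : x 0 ≠ 0)
    (h0 : p • x 0 = 0) (hs : ∀ n, p • x (n + 1) = x n)
    (hfin : {c : G | c ∈ N ∧ p • c = 0}.Finite) (hcard : Set.ncard {c : G | c ∈ N ∧ p • c = 0} ≤ p)
    (n : ℕ) {c : G} (hcN : c ∈ N) (hc : p ^ (n + 1) • c = 0) : ∃ m : ℕ, c = m • x n := by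
  classical
  -- level 0: `N[p]` is exactly the set of multiples `m • x₀`, `m < p`
  have hlevel0 : ∀ c ∈ N, p • c = 0 → ∃ m : ℕ, c = m • x 0 := by
    intro c hcN hc
    set S : Set G := (fun m : ℕ => m • x 0) '' Set.Iio p with hS
    have hsub : S ⊆ {c : G | c ∈ N ∧ p • c = 0} := by
      rintro _ ⟨m, -, rfl⟩
      refine ⟨N.nsmul_mem (hxN 0) m, ?_⟩
      rw [← mul_smul, mul_comm, mul_smul, h0, smul_zero]
    have hord : addOrderOf (x 0) = p := by
      have h := addOrderOf_chain hx0 h0 hs 0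
      rwa [zero_add, pow_one] at h
    have hinj : Set.InjOn (fun m : ℕ => m • x 0) (Set.Iio p) := by
      rw [← hord]; exact nsmul_injOn_Iio_addOrderOf
    have hScard : S.ncard = p := by
      rw [hS, hinj.ncard_image, Set.ncard_eq_toFinset_card' (Set.Iio p)]
      simp
    have heq : S = {c : G | c ∈ N ∧ p • c = 0} :=
      Set.eq_of_subset_of_ncard_le hsub (by rw [hScard]; exact hcard) hfin
    have hmem : c ∈ S := by rw [heq]; exact ⟨hcN, hc⟩
    obtain ⟨m, -, hm⟩ := hmem
    exact ⟨m, hm.symm⟩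
  -- induction on the level
  induction n generalizing c with
  | zero => exact hlevel0 c hcN (by rwa [zero_add, pow_one] at hc)
  | succ n ih =>
    -- `p • c` is at level `n`
    have hpc : p ^ (n + 1) • (p • c) = 0 := by rw [← mul_smul, ← pow_succ, hc]
    obtain ⟨m, hm⟩ := ih (N.nsmul_mem hcN p) hpc
    -- `c - m • x (n+1)` is killed by `p`
    have hdiff : p • (c - m • x (n + 1)) = 0 := by
      rw [smul_sub, hm, ← mul_smul, mul_comm, mul_smul, hs n, sub_self]
    obtain ⟨m', hm'⟩ := hlevel0 _ (N.sub_mem hcN (N.nsmul_mem (hxN _) m)) hdiff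
    refine ⟨m + m' * p ^ (n + 1), ?_⟩
    rw [add_smul, mul_smul, (pow_smul_chain h0 hs (n + 1)).1, ← hm', add_sub_cancel]

variable {D : Type*} [Monoid D] [DistribMulAction D G]

/-- **`D` acts on `xₙ` by scalars**: for a `D`-stable `N` as above, `d • xₙ = m • xₙ` for some
`m < p^{n+1}` (`d • xₙ ∈ N[p^{n+1}] = ⟨xₙ⟩`). [cite: Serre1967GroupesPDivisibles, §5 Prop. 8 (proof)] -/
theorem exists_smul_chain_eq_nsmul (hstab : ∀ d : D, ∀ c ∈ N, d • c ∈ N) {x : ℕ → G}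
    (hxN : ∀ n, x n ∈ N) (hx0 : x 0 ≠ 0) (h0 : p • x 0 = 0) (hs : ∀ n, p • x (n + 1) = x n)
    (hfin : {c : G | c ∈ N ∧ p • c = 0}.Finite) (hcard : Set.ncard {c : G | c ∈ N ∧ p • c = 0} ≤ p)
    (d : D) (n : ℕ) : ∃ m : ℕ, m < p ^ (n + 1) ∧ d • x n = m • x n := by
  have hkill : p ^ (n + 1) • (d • x n) = 0 := by
    rw [smul_comm, (pow_smul_chain h0 hs n).2, smul_zero]
  obtain ⟨m, hm⟩ := mem_range_nsmul_chain_of_mem hxN hx0 h0 hs hfin hcard n (hstab d _ (hxN n)) hkill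
  refine ⟨m % p ^ (n + 1), Nat.mod_lt _ (pow_pos hp.out.pos _), ?_⟩
  rw [hm]
  have hsplit : m = m % p ^ (n + 1) + (m / p ^ (n + 1)) * p ^ (n + 1) := by
    rw [Nat.mul_comm]; exact (Nat.mod_add_div m _).symm
  conv_lhs => rw [hsplit]
  rw [add_smul, mul_smul, (pow_smul_chain h0 hs n).2, smul_zero, add_zero]

/-- **The orbit bound**: the `D`-orbit of `xₙ` has at most `p^{n+1}` elements (it lies in the set of
multiples `m • xₙ`, `m < p^{n+1}`) — for `D` a decomposition group, `[K_𝔭(xₙ) : K_𝔭] ≤ p^{n+1}`, the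
degree count that Lemme 3's ramification bound `≥ c·p^{2n}` defeats for large `n`.
[cite: Serre1967GroupesPDivisibles, §5 Prop. 8 (proof)] -/
theorem ncard_orbit_chain_le (hstab : ∀ d : D, ∀ c ∈ N, d • c ∈ N) {x : ℕ → G}
    (hxN : ∀ n, x n ∈ N) (hx0 : x 0 ≠ 0) (h0 : p • x 0 = 0) (hs : ∀ n, p • x (n + 1) = x n)
    (hfin : {c : G | c ∈ N ∧ p • c = 0}.Finite) (hcard : Set.ncard {c : G | c ∈ N ∧ p • c = 0} ≤ p)
    (n : ℕ) : Set.ncard (Set.range fun d : D => d • x n) ≤ p ^ (n + 1) := by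
  classical
  set S : Set G := (fun m : ℕ => m • x n) '' Set.Iio (p ^ (n + 1)) with hS
  have hSfin : S.Finite := (Set.finite_Iio _).image _
  have hsub : (Set.range fun d : D => d • x n) ⊆ S := by
    rintro _ ⟨d, rfl⟩
    obtain ⟨m, hm, hdm⟩ := exists_smul_chain_eq_nsmul hstab hxN hx0 h0 hs hfin hcard d n
    exact ⟨m, hm, hdm.symm⟩
  calc Set.ncard (Set.range fun d : D => d • x n) ≤ S.ncard := Set.ncard_le_ncard hsub hSfin
    _ ≤ (Set.Iio (p ^ (n + 1))).ncard := Set.ncard_image_le (Set.finite_Iio _)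
    _ = p ^ (n + 1) := by rw [Set.ncard_eq_toFinset_card' (Set.Iio _)]; simp

end Literature.NumberTheory.EllipticCurves.Serre1967
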